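import Literature.NumberTheory.LFunctions.SimpleZeros
import Literature.NumberTheory.LFunctions.MontgomeryExplicitFormulaProofs
import Literature.NumberTheory.LFunctions.ZetaOrdinateDictionary
import Literature.NumberTheory.LFunctions.ZeroGapsProofs
import HarnessLib

/-!
# Montgomery 1973: `∑ m(ρ)² ≤ (4/3 + o(1)) N(T)` on RH, and `κ* ≥ 2/3`, `κ_d ≥ 5/6` — proofs

Topic `Literature/NumberTheory/LFunctions`. Proofs only (no definitions, no named facts). Companion
of `SimpleZeros.lean`, DISCHARGING its three Montgomery named facts:

* `Literature.NumberTheory.LFunctions.Montgomery1973_sum_sq_multiplicity_holds` — assuming RH,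
  `∑'_{0<γ≤T} m(ρ)² ≤ (4/3 + o(1)) N(T)` (Montgomery 1973, §3, Corollary of the Theorem; Titchmarsh
  §14.34, the display before (14.34.3); Goldston 2005, §5);
* `Literature.NumberTheory.LFunctions.Montgomery1973_simple_zeros_holds` (`N⁽¹⁾(T) ≥ (2/3 + o(1)) N(T)`,
  Titchmarsh (14.34.3)) and `Literature.NumberTheory.LFunctions.Montgomery1973_distinct_zeros_holds`
  (`N_d(T) ≥ (5/6 + o(1)) N(T)`, as reported by Bui–Heath-Brown 2013, §1), by the counting
  deductions already proved in `SimpleZeros.lean`.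

## The printed proof and its rendering

Montgomery's Theorem (PROVED in the tree: `montgomery_pair_correlation_restricted_holds`,
`MontgomeryExplicitFormulaProofs.lean`) gives, on RH, `F(α, T) = (1 + o(1)) T^{-2α} log T + α + o(1)`
uniformly for `0 ≤ α ≤ 1 − δ`, where
`F(α, T) = (2π/(T log T)) ∑_{0<γ,γ'≤T} T^{iα(γ−γ')} w(γ−γ')` (`montgomeryFormFactor`). Montgomery
(§3) integrates `F` against a Fejér kernel: for a kernel `r̂ ≥ 0` supported in `[−β, β]` with
Fourier transform `r ≥ 0`, `r(0) = 1`, the diagonal terms `γ = γ'` of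
`∑_{γ,γ'} r((γ−γ') log T/2π) w(γ−γ') = (T log T/2π) ∫ F(α) r̂(α) dα` already give
`∑_{γ = γ'} 1 ≤ (T log T/2π) ∫ F r̂`, and `∑_{γ=γ'} 1` (pairs counted with multiplicity) is
`∑_ρ m(ρ)²` over the distinct zeros. We run this with the one-sided triangle `r̂(α) = (β − α)` on
`[0, β]`, `β < 1` (so that only the *restricted* range `0 ≤ α ≤ 1 − δ` of the Theorem is needed):

* (A, dictionary) `∑_{ρ ∈ box} m(ρ)² ≤ D(T) := #{(i, j) : i, j < N(T), γ_i = γ_j}`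
  (`finsum_sq_order_le_card_diag`; equality under RH), via the ordinate dictionary of
  `ZetaOrdinateDictionary.lean`;
* (B1) the kernel `k(y) = ∫_0^β (β − α) cos(α y) dα = (1 − cos βy)/y² ≥ 0`, `k(0) = β²/2`;
* (B2) `∫_0^β F(α, T)(β − α) dα = (2π/(T log T)) ∑_{i,j} w(γ_i − γ_j) k(log T (γ_i − γ_j))
  ≥ (2π/(T log T)) · D(T) · β²/2` (`w > 0`, `w(0) = 1`);
* (B3) by the Theorem, `∫_0^β F(α, T)(β − α) dα ≤ (1 + ε₁) β/2 + β³/6 + ε₁ β²` for large `T`, whence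
  `D(T) ≤ (T log T/2π) ((1 + ε₁)/β + β/3 + 2ε₁)`, and `T log T/2π ≤ (1 + ε₂) N(T)`
  (Riemann–von Mangoldt, `ZeroGapsProofs.eventually_mul_log_le`);
* (C) `β → 1`, `ε₁, ε₂ → 0`: `1/β + β/3 → 4/3`.

## References

* H. L. Montgomery, *The pair correlation of zeros of the zeta function*, Proc. Sympos. Pure Math.
  24, AMS (1973), 181–193: Theorem and §3 (Corollaries). [key `Montgomery1973`]
* E. C. Titchmarsh, *The Theory of the Riemann Zeta-Function*, 2nd ed. revised by D. R. Heath-Brown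
  (1986), §14.34, (14.34.1)–(14.34.3). [key `Titchmarsh1986`]
* D. A. Goldston, *Notes on pair correlation of zeros and prime numbers* (2005), §5. [key `Goldston2005`]
* H. M. Bui, D. R. Heath-Brown, *On simple zeros of the Riemann zeta-function*, Bull. LMS 45 (2013),
  §1. [key `BuiHeathbrown2013`]
-/

noncomputable section

open Complex Filter Set MeasureTheory
open scoped Real Topology

namespace Literature.NumberTheory.LFunctions

namespace SimpleZerosProofs

/-! ## (A) The dictionary step: `∑ m(ρ)² ≤ #{(i, j) : γ_i = γ_j}` -/

/-- **Pairs of equal ordinates dominate the squared multiplicities.** For every `T`,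
`∑_{ρ : 0 < Im ρ ≤ T} m(ρ)² ≤ #{(i, j) : i, j < N(T), γ_i = γ_j}`, the sum over the distinct zeros of
the box and the pairs over indices of the enumeration `γ_n` (with multiplicity). Grouping by height
`y`, the right side is `∑_y c(y)²` and the left side `∑_y ∑_{Im ρ = y} m(ρ)² ≤ ∑_y c(y)²`, where
`c(y) = ∑_{Im ρ = y} m(ρ) = #{n < N(T) : γ_n = y}` (`OrdinateDictionary.card_filter_zetaOrdinate_eq`).
(Montgomery 1973, §3: "the terms `γ = γ'` contribute `∑ m(ρ)²`"; under RH this is an equality.)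
[cite: Montgomery1973, §3] -/
theorem finsum_sq_order_le_card_diag (T : ℝ) :
    (∑ᶠ ρ ∈ zetaZeroBox 0 T, riemannZetaZeroOrder ρ ^ 2 : ℤ) ≤
      (((zeroIndexSet T ×ˢ zeroIndexSet T).filter
          fun p ↦ zetaOrdinate p.1 = zetaOrdinate p.2).card : ℤ) := by
  classical
  obtain ⟨c, hc⟩ : ∃ c : ℝ → ℤ, ∀ y, c y =
      ∑ ρ ∈ (zetaZeroBox_finite 0 T).toFinset.filter (fun ρ ↦ ρ.im = y), riemannZetaZeroOrder ρ :=
    ⟨_, fun _ ↦ rfl⟩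
  have hpos : ∀ ρ ∈ (zetaZeroBox_finite 0 T).toFinset, 0 < riemannZetaZeroOrder ρ := fun ρ hρ ↦
    DiophantineGeometry.riemannZetaZeroOrder_pos_of_mem_zetaZeroBox ((Set.Finite.mem_toFinset _).1 hρ)
  -- (1) `D = ∑_{i < N} c(γ_i)`
  have h1 : (((zeroIndexSet T ×ˢ zeroIndexSet T).filter
        fun p ↦ zetaOrdinate p.1 = zetaOrdinate p.2).card : ℤ) =
      ∑ i ∈ Finset.range (zetaZeroCount T), c (zetaOrdinate i) := by
    rw [Finset.card_filter, zeroIndexSet, Finset.sum_product]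
    push_cast
    refine Finset.sum_congr rfl fun i hi ↦ ?_
    have hy : zetaOrdinate i ∈ (zetaZeroBox_finite 0 T).toFinset.image Complex.im := by
      obtain ⟨ρ, hρ, hρi⟩ :=
        OrdinateDictionary.exists_mem_zetaZeroBox_im_eq (Finset.mem_range.1 hi)
      exact Finset.mem_image.2 ⟨ρ, (Set.Finite.mem_toFinset _).2 hρ, hρi⟩
    rw [hc, ← OrdinateDictionary.card_filter_zetaOrdinate_eq hy, Finset.card_filter]
    push_cast
    exact Finset.sum_congr rfl fun j _ ↦ if_congr eq_comm rfl rfl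
  -- (2) `∑_{i < N} c(γ_i) = ∑_ρ m(ρ) c(Im ρ)` (the finite dictionary)
  have h2 : ∑ i ∈ Finset.range (zetaZeroCount T), c (zetaOrdinate i) =
      ∑ ρ ∈ (zetaZeroBox_finite 0 T).toFinset, riemannZetaZeroOrder ρ * c ρ.im := by
    have := OrdinateDictionary.sum_zetaZeroBox_mul_eq_sum_range (fun y ↦ ((c y : ℤ) : ℂ)) T
    exact_mod_cast this.symm
  -- (3) `m(ρ) ≤ c(Im ρ)` (all multiplicities of the fibre are positive)
  have h3 : ∀ ρ ∈ (zetaZeroBox_finite 0 T).toFinset, riemannZetaZeroOrder ρ ≤ c ρ.im := by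
    intro ρ hρ
    rw [hc]
    exact Finset.single_le_sum (f := riemannZetaZeroOrder)
      (fun ρ' hρ' ↦ (hpos ρ' (Finset.mem_filter.1 hρ').1).le) (Finset.mem_filter.2 ⟨hρ, rfl⟩)
  rw [finsum_mem_eq_finite_toFinset_sum _ (zetaZeroBox_finite 0 T), h1, h2]
  refine Finset.sum_le_sum fun ρ hρ ↦ ?_
  rw [sq]
  exact mul_le_mul_of_nonneg_left (h3 ρ hρ) (hpos ρ hρ).le

/-! ## (B1) The one-sided Fejér kernel `k(y) = ∫_0^β (β − α) cos(α y) dα` -/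

/-- `∫_0^β (β − α) cos(α y) dα = (1 − cos(β y))/y²` for `y ≠ 0` (an antiderivative is
`(β − α) sin(α y)/y − cos(α y)/y²`). [folklore] -/
theorem integral_sub_mul_cos_of_ne_zero (β : ℝ) {y : ℝ} (hy : y ≠ 0) :
    ∫ α in (0 : ℝ)..β, (β - α) * Real.cos (α * y) = (1 - Real.cos (β * y)) / y ^ 2 := by
  have hderiv : ∀ α ∈ Set.uIcc (0 : ℝ) β,
      HasDerivAt (fun α : ℝ ↦ (β - α) * Real.sin (α * y) / y - Real.cos (α * y) / y ^ 2)
        ((β - α) * Real.cos (α * y)) α := by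
    intro α _
    have h1 : HasDerivAt (fun α : ℝ ↦ α * y) y α := by
      simpa using (hasDerivAt_id α).mul_const y
    have h4 : HasDerivAt (fun α : ℝ ↦ β - α) (-1) α := by
      simpa using (hasDerivAt_id α).const_sub β
    refine (((h4.mul h1.sin).div_const y).sub (h1.cos.div_const (y ^ 2))).congr_deriv ?_
    field_simp
    ring
  rw [intervalIntegral.integral_eq_sub_of_hasDerivAt hderiv
    ((by fun_prop : Continuous fun α : ℝ ↦ (β - α) * Real.cos (α * y)).intervalIntegrable _ _)]
  simp only [sub_self, zero_mul, zero_div, zero_sub, Real.sin_zero, Real.cos_zero, mul_zero]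
  ring

/-- `∫_0^β (β − α) dα = β²/2` (the kernel at `y = 0`). [folklore] -/
theorem integral_sub_mul_cos_zero (β : ℝ) :
    ∫ α in (0 : ℝ)..β, (β - α) * Real.cos (α * 0) = β ^ 2 / 2 := by
  have hderiv : ∀ α ∈ Set.uIcc (0 : ℝ) β,
      HasDerivAt (fun α : ℝ ↦ β * α - α ^ 2 / 2) ((β - α) * Real.cos (α * 0)) α := by
    intro α _
    rw [mul_zero, Real.cos_zero, mul_one]
    have h1 : HasDerivAt (fun α : ℝ ↦ β * α) β α := by
      simpa using (hasDerivAt_id α).const_mul β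
    have h2 : HasDerivAt (fun α : ℝ ↦ α ^ 2 / 2) α α :=
      ((hasDerivAt_pow 2 α).div_const 2).congr_deriv (by norm_num)
    exact h1.sub h2
  rw [intervalIntegral.integral_eq_sub_of_hasDerivAt hderiv
    ((by fun_prop : Continuous fun α : ℝ ↦ (β - α) * Real.cos (α * 0)).intervalIntegrable _ _)]
  norm_num
  ring

/-- The kernel is non-negative: `0 ≤ ∫_0^β (β − α) cos(α y) dα` for all real `y`
(`= (1 − cos βy)/y²` or `β²/2`). This positivity is what lets the off-diagonal pairs be dropped.
[folklore] -/
theorem integral_sub_mul_cos_nonneg (β y : ℝ) :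
    0 ≤ ∫ α in (0 : ℝ)..β, (β - α) * Real.cos (α * y) := by
  rcases eq_or_ne y 0 with rfl | hy
  · rw [integral_sub_mul_cos_zero]; positivity
  · rw [integral_sub_mul_cos_of_ne_zero β hy]
    exact div_nonneg (sub_nonneg.2 (Real.cos_le_one _)) (sq_nonneg _)

/-! ## (B2) Integrating the form factor against the kernel: the diagonal lower bound -/

/-- `w(0) = 1` for Montgomery's weight `w(u) = 4/(4 + u²)`. [cite: Montgomery1973, §1 (1)] -/
theorem montgomeryWeight_zero : montgomeryWeight 0 = 1 := by
  norm_num [montgomeryWeight]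

/-- **Expansion** (Montgomery 1973, §3, first display: "`∑_{γ,γ'} r((γ−γ') L/2π) w(γ−γ') =
(TL/2π) ∫ F(α) r̂(α) dα`", here for the one-sided triangle `r̂ = (β − α)·1_{[0,β]}`):
`∫_0^β F(α, T)(β − α) dα = (2π/(T log T)) ∑_{i,j < N(T)} w(γ_i − γ_j) k(log T · (γ_i − γ_j))` with
`k(y) = ∫_0^β (β − α) cos(α y) dα`. [cite: Montgomery1973, §3] -/
theorem integral_montgomeryFormFactor_mul_sub (T β : ℝ) :
    ∫ α in (0 : ℝ)..β, montgomeryFormFactor α T * (β - α) =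
      2 * π / (T * Real.log T) * ∑ p ∈ zeroIndexSet T ×ˢ zeroIndexSet T,
        montgomeryWeight (zetaOrdinate p.1 - zetaOrdinate p.2) *
          ∫ α in (0 : ℝ)..β, (β - α) *
            Real.cos (α * (Real.log T * (zetaOrdinate p.1 - zetaOrdinate p.2))) := by
  have hpt : ∀ α : ℝ, montgomeryFormFactor α T * (β - α) =
      2 * π / (T * Real.log T) * ∑ p ∈ zeroIndexSet T ×ˢ zeroIndexSet T,
        montgomeryWeight (zetaOrdinate p.1 - zetaOrdinate p.2) *
          ((β - α) * Real.cos (α * (Real.log T * (zetaOrdinate p.1 - zetaOrdinate p.2)))) := by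
    intro α
    simp only [montgomeryFormFactor, mul_assoc]
    rw [Finset.sum_mul]
    congr 1
    exact Finset.sum_congr rfl fun p _ ↦ by ring
  simp_rw [hpt]
  rw [intervalIntegral.integral_const_mul, intervalIntegral.integral_finsetSum]
  · congr 1
    exact Finset.sum_congr rfl fun p _ ↦ intervalIntegral.integral_const_mul _ _
  · intro p _
    exact (Continuous.intervalIntegrable (by fun_prop) _ _)

/-- **The diagonal lower bound** (Montgomery 1973, §3: the terms `γ = γ'` of
`∑_{γ,γ'} r(·) w(γ − γ')`, all other terms being `≥ 0`): since `w > 0`, `k ≥ 0`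
(`integral_sub_mul_cos_nonneg`), `w(0) = 1` and `k(0) = β²/2`,
`#{(i, j) : γ_i = γ_j} · β²/2 ≤ ∑_{i,j} w(γ_i − γ_j) k(log T (γ_i − γ_j))`. [cite: Montgomery1973, §3] -/
theorem card_diag_mul_le_sum (T β : ℝ) :
    (((zeroIndexSet T ×ˢ zeroIndexSet T).filter
          fun p ↦ zetaOrdinate p.1 = zetaOrdinate p.2).card : ℝ) * (β ^ 2 / 2) ≤
      ∑ p ∈ zeroIndexSet T ×ˢ zeroIndexSet T,
        montgomeryWeight (zetaOrdinate p.1 - zetaOrdinate p.2) *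
          ∫ α in (0 : ℝ)..β, (β - α) *
            Real.cos (α * (Real.log T * (zetaOrdinate p.1 - zetaOrdinate p.2))) := by
  classical
  calc (((zeroIndexSet T ×ˢ zeroIndexSet T).filter
          fun p ↦ zetaOrdinate p.1 = zetaOrdinate p.2).card : ℝ) * (β ^ 2 / 2)
      = ∑ p ∈ (zeroIndexSet T ×ˢ zeroIndexSet T).filter
            fun p ↦ zetaOrdinate p.1 = zetaOrdinate p.2, β ^ 2 / 2 := by
        rw [Finset.sum_const, nsmul_eq_mul]
    _ = ∑ p ∈ (zeroIndexSet T ×ˢ zeroIndexSet T).filter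
            fun p ↦ zetaOrdinate p.1 = zetaOrdinate p.2,
          montgomeryWeight (zetaOrdinate p.1 - zetaOrdinate p.2) *
            ∫ α in (0 : ℝ)..β, (β - α) *
              Real.cos (α * (Real.log T * (zetaOrdinate p.1 - zetaOrdinate p.2))) := by
        refine Finset.sum_congr rfl fun p hp ↦ ?_
        rw [(Finset.mem_filter.1 hp).2, sub_self, mul_zero, montgomeryWeight_zero,
          integral_sub_mul_cos_zero, one_mul]
    _ ≤ _ := Finset.sum_le_sum_of_subset_of_nonneg (Finset.filter_subset _ _) fun p _ _ ↦
        mul_nonneg (montgomeryWeight_pos _).le (integral_sub_mul_cos_nonneg _ _)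

/-! ## (B3) The upper bound from Montgomery's theorem -/

/-- **Integrating Montgomery's theorem against the kernel.** Assuming RH, for `0 < β < 1` and
`ε₁ > 0`, for all large `T`:
`∫_0^β F(α, T)(β − α) dα ≤ (1 + ε₁) β/2 + β³/6 + ε₁ β²`. Indeed on `[0, β]` the Theorem (restricted
range `α ≤ 1 − δ`, `δ = 1 − β`; `montgomery_pair_correlation_restricted_holds`) gives
`F(α, T) ≤ (1 + ε₁) T^{−2α} log T + α + ε₁`, so the integrand is at most
`(1 + ε₁) β L e^{−2Lα} + α(β − α) + ε₁ β` (`L = log T`), whose integral over `[0, β]` is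
`(1 + ε₁) β (1 − e^{−2Lβ})/2 + β³/6 + ε₁ β²` (this is Montgomery's
`∫ F r̂ = ∫ (T^{−2|α|} L + |α|) r̂ + o(1)`, §3). [cite: Montgomery1973, §3] -/
theorem eventually_integral_montgomeryFormFactor_mul_sub_le (hRH : RiemannHypothesis) {β ε₁ : ℝ}
    (hβ0 : 0 < β) (hβ1 : β < 1) (hε₁ : 0 < ε₁) :
    ∀ᶠ T : ℝ in atTop, ∫ α in (0 : ℝ)..β, montgomeryFormFactor α T * (β - α) ≤
      (1 + ε₁) * β / 2 + β ^ 3 / 6 + ε₁ * β ^ 2 := by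
  have hM : ∀ᶠ T : ℝ in atTop, ∀ α : ℝ, |α| ≤ 1 - (1 - β) →
      |montgomeryFormFactor α T - (T ^ (-2 * |α|) * Real.log T + |α|)| ≤
        ε₁ * (T ^ (-2 * |α|) * Real.log T) + ε₁ :=
    montgomery_pair_correlation_restricted_holds hRH (by linarith) hε₁
  filter_upwards [hM, eventually_gt_atTop (1 : ℝ)] with T hT hT1
  have hT0 : 0 < T := by linarith
  have hL : 0 < Real.log T := Real.log_pos hT1
  -- pointwise bound on `[0, β]`
  have hpt : ∀ α ∈ Set.Icc (0 : ℝ) β, montgomeryFormFactor α T * (β - α) ≤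
      (1 + ε₁) * β * (Real.exp (-(2 * Real.log T) * α) * Real.log T) + α * (β - α) + ε₁ * β := by
    intro α hα
    obtain ⟨hα0, hαβ⟩ := hα
    have h := hT α (by rw [abs_of_nonneg hα0]; linarith)
    rw [abs_of_nonneg hα0] at h
    have hrpow : T ^ (-2 * α) = Real.exp (-(2 * Real.log T) * α) := by
      rw [Real.rpow_def_of_pos hT0]
      congr 1
      ring
    rw [hrpow] at h
    have hE : 0 ≤ Real.exp (-(2 * Real.log T) * α) * Real.log T := by positivity
    have hF : montgomeryFormFactor α T ≤
        (1 + ε₁) * (Real.exp (-(2 * Real.log T) * α) * Real.log T) + α + ε₁ := by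
      linarith [(abs_le.1 h).2]
    calc montgomeryFormFactor α T * (β - α)
        ≤ ((1 + ε₁) * (Real.exp (-(2 * Real.log T) * α) * Real.log T) + α + ε₁) * (β - α) :=
          mul_le_mul_of_nonneg_right hF (by linarith)
      _ ≤ (1 + ε₁) * β * (Real.exp (-(2 * Real.log T) * α) * Real.log T) + α * (β - α) + ε₁ * β := by
          nlinarith [mul_nonneg (mul_nonneg (by linarith : (0 : ℝ) ≤ 1 + ε₁) hE) hα0,
            mul_nonneg hε₁.le hα0]
  -- an antiderivative of the majorant
  have hderiv : ∀ α ∈ Set.uIcc (0 : ℝ) β, HasDerivAt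
      (fun α : ℝ ↦ -(1 + ε₁) * β * Real.exp (-(2 * Real.log T) * α) / 2 + β * α ^ 2 / 2 -
        α ^ 3 / 3 + ε₁ * β * α)
      ((1 + ε₁) * β * (Real.exp (-(2 * Real.log T) * α) * Real.log T) + α * (β - α) + ε₁ * β) α := by
    intro α _
    have h1 : HasDerivAt (fun α : ℝ ↦ -(2 * Real.log T) * α) (-(2 * Real.log T)) α := by
      simpa using (hasDerivAt_id α).const_mul (-(2 * Real.log T))
    have h2 : HasDerivAt (fun α : ℝ ↦ β * α ^ 2 / 2) (β * (↑(2 : ℕ) * α ^ (2 - 1)) / 2) α :=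
      ((hasDerivAt_pow 2 α).const_mul β).div_const 2
    have h3 : HasDerivAt (fun α : ℝ ↦ α ^ 3 / 3) (↑(3 : ℕ) * α ^ (3 - 1) / 3) α :=
      (hasDerivAt_pow 3 α).div_const 3
    have h4 : HasDerivAt (fun α : ℝ ↦ ε₁ * β * α) (ε₁ * β) α := by
      simpa using (hasDerivAt_id α).const_mul (ε₁ * β)
    refine (((((h1.exp.const_mul (-(1 + ε₁) * β)).div_const 2).add h2).sub h3).add h4).congr_deriv ?_
    norm_num
    ring
  have hint := intervalIntegral.integral_eq_sub_of_hasDerivAt hderiv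
    ((by fun_prop : Continuous fun α : ℝ ↦ (1 + ε₁) * β *
      (Real.exp (-(2 * Real.log T) * α) * Real.log T) + α * (β - α) + ε₁ * β).intervalIntegrable
      (μ := volume) _ _)
  have hmono := intervalIntegral.integral_mono_on hβ0.le
    ((show Continuous fun α : ℝ ↦ montgomeryFormFactor α T * (β - α) by
        unfold montgomeryFormFactor; fun_prop).intervalIntegrable (μ := volume) _ _)
    ((by fun_prop : Continuous fun α : ℝ ↦ (1 + ε₁) * β *
      (Real.exp (-(2 * Real.log T) * α) * Real.log T) + α * (β - α) + ε₁ * β).intervalIntegrable _ _)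
    hpt
  refine hmono.trans ?_
  rw [hint]
  have hpos : 0 ≤ (1 + ε₁) * β * Real.exp (-(2 * Real.log T) * β) := by positivity
  simp only [mul_zero, Real.exp_zero]
  nlinarith [hpos]

/-- **The count of equal pairs** (Montgomery 1973, §3, assembled): assuming RH, for `0 < β < 1`,
`ε₁, ε₂ > 0` and all large `T`,
`#{(i, j) : i, j < N(T), γ_i = γ_j} ≤ (1 + ε₂)((1 + ε₁)/β + β/3 + 2ε₁) N(T)`: combine
`card_diag_mul_le_sum`, `integral_montgomeryFormFactor_mul_sub`,
`eventually_integral_montgomeryFormFactor_mul_sub_le` and `(T/2π) log T ≤ (1 + ε₂) N(T)`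
(`ZeroGapsProofs.eventually_mul_log_le`). [cite: Montgomery1973, §3] -/
theorem eventually_card_diag_le (hRH : RiemannHypothesis) {β ε₁ ε₂ : ℝ} (hβ0 : 0 < β) (hβ1 : β < 1)
    (hε₁ : 0 < ε₁) (hε₂ : 0 < ε₂) :
    ∀ᶠ T : ℝ in atTop,
      (((zeroIndexSet T ×ˢ zeroIndexSet T).filter
          fun p ↦ zetaOrdinate p.1 = zetaOrdinate p.2).card : ℝ) ≤
        (1 + ε₂) * ((1 + ε₁) / β + β / 3 + 2 * ε₁) * zetaZeroCount T := by
  filter_upwards [eventually_integral_montgomeryFormFactor_mul_sub_le hRH hβ0 hβ1 hε₁,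
    ZeroGapsProofs.eventually_mul_log_le hε₂, eventually_gt_atTop (1 : ℝ)] with T hU hN hT1
  have hT0 : 0 < T := by linarith
  have hL : 0 < Real.log T := Real.log_pos hT1
  have hQ := card_diag_mul_le_sum T β
  have hI := integral_montgomeryFormFactor_mul_sub T β
  have hκ : 0 < 2 * π / (T * Real.log T) := by positivity
  -- `Q = (T log T / 2π) ∫ F (β − α) ≤ (T log T / 2π) U`
  have hQU : ∑ p ∈ zeroIndexSet T ×ˢ zeroIndexSet T,
      montgomeryWeight (zetaOrdinate p.1 - zetaOrdinate p.2) *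
        ∫ α in (0 : ℝ)..β, (β - α) *
          Real.cos (α * (Real.log T * (zetaOrdinate p.1 - zetaOrdinate p.2))) ≤
      ((1 + ε₁) * β / 2 + β ^ 3 / 6 + ε₁ * β ^ 2) / (2 * π / (T * Real.log T)) := by
    rw [le_div_iff₀' hκ, ← hI]
    exact hU
  have hD := hQ.trans hQU
  rw [← le_div_iff₀ (by positivity : (0 : ℝ) < β ^ 2 / 2)] at hD
  have hc : 0 ≤ (1 + ε₁) / β + β / 3 + 2 * ε₁ := by positivity
  calc (((zeroIndexSet T ×ˢ zeroIndexSet T).filter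
          fun p ↦ zetaOrdinate p.1 = zetaOrdinate p.2).card : ℝ)
      ≤ ((1 + ε₁) * β / 2 + β ^ 3 / 6 + ε₁ * β ^ 2) / (2 * π / (T * Real.log T)) / (β ^ 2 / 2) := hD
    _ = T / (2 * π) * Real.log T * ((1 + ε₁) / β + β / 3 + 2 * ε₁) := by
      field_simp
      ring
    _ ≤ (1 + ε₂) * zetaZeroCount T * ((1 + ε₁) / β + β / 3 + 2 * ε₁) :=
      mul_le_mul_of_nonneg_right hN hc
    _ = (1 + ε₂) * ((1 + ε₁) / β + β / 3 + 2 * ε₁) * zetaZeroCount T := by ring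

end SimpleZerosProofs

/-! ## (C) The discharges -/

/-- **DISCHARGE of `Literature.NumberTheory.LFunctions.Montgomery1973_sum_sq_multiplicity`**
(Montgomery 1973, §3, Corollary of the Theorem; Titchmarsh §14.34: "Using (14.34.1), Montgomery
showed that `∑'_{0<γ≤T} m(ρ)² ≤ {4/3 + o(1)} N(T)`", on RH). Proof as in §3 of Montgomery's
paper, from his Theorem (`montgomery_pair_correlation_restricted_holds`, proved in the tree) and
the one-sided Fejér kernel on `[0, β]`: `∑ m(ρ)² ≤ D(T) ≤ (1 + ε₂)((1 + ε₁)/β + β/3 + 2ε₁) N(T)`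
(`SimpleZerosProofs.finsum_sq_order_le_card_diag`, `SimpleZerosProofs.eventually_card_diag_le`),
with `β = 1 − ε/8`, `ε₁ = ε/22`, `ε₂ = ε/3` (for `ε ≤ 1`). [cite: Montgomery1973, Theorem and §3]
[cite: Titchmarsh1986, §14.34] -/
theorem Montgomery1973_sum_sq_multiplicity_holds : Montgomery1973_sum_sq_multiplicity := by
  intro hRH ε hε
  wlog hε1 : ε ≤ 1 generalizing ε
  · push Not at hε1
    filter_upwards [this 1 one_pos le_rfl] with T hT
    have hN : (0 : ℝ) ≤ zetaZeroCount T := Nat.cast_nonneg _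
    nlinarith [mul_nonneg (by linarith : (0 : ℝ) ≤ ε - 1) hN]
  have key := SimpleZerosProofs.eventually_card_diag_le hRH (β := 1 - ε / 8) (ε₁ := ε / 22)
    (ε₂ := ε / 3) (by linarith) (by linarith) (by positivity) (by positivity)
  filter_upwards [key] with T hT
  have hA : ((∑ᶠ ρ ∈ zetaZeroBox 0 T, riemannZetaZeroOrder ρ ^ 2 : ℤ) : ℝ) ≤
      (((zeroIndexSet T ×ˢ zeroIndexSet T).filter
          fun p ↦ zetaOrdinate p.1 = zetaOrdinate p.2).card : ℝ) := by
    exact_mod_cast SimpleZerosProofs.finsum_sq_order_le_card_diag T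
  have hN : (0 : ℝ) ≤ zetaZeroCount T := Nat.cast_nonneg _
  have hβ : (0 : ℝ) < 1 - ε / 8 := by linarith
  have hsq : ε * ε ≤ ε * 1 := mul_le_mul_of_nonneg_left hε1 hε.le
  have h1 : (1 + ε / 22) / (1 - ε / 8) ≤ 1 + ε / 22 + ε / 6 := by
    rw [div_le_iff₀ hβ]
    nlinarith [hsq]
  have hc : (1 + ε / 3) * ((1 + ε / 22) / (1 - ε / 8) + (1 - ε / 8) / 3 + 2 * (ε / 22)) ≤
      4 / 3 + ε := by
    nlinarith [hsq, mul_le_mul_of_nonneg_left h1 (by positivity : (0 : ℝ) ≤ 1 + ε / 3)]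
  calc ((∑ᶠ ρ ∈ zetaZeroBox 0 T, riemannZetaZeroOrder ρ ^ 2 : ℤ) : ℝ)
      ≤ _ := hA
    _ ≤ _ := hT
    _ ≤ (4 / 3 + ε) * zetaZeroCount T := mul_le_mul_of_nonneg_right hc hN

/-- **DISCHARGE of `Literature.NumberTheory.LFunctions.Montgomery1973_simple_zeros`** (Montgomery
1973; Titchmarsh §14.34, (14.34.3): on RH, `N⁽¹⁾(T) ≥ {2/3 + o(1)} N(T)`): Titchmarsh's "one may
deduce" (`Montgomery1973_simple_zeros_of_sum_sq_multiplicity`, `SimpleZeros.lean`) applied to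
`Montgomery1973_sum_sq_multiplicity_holds`. [cite: Titchmarsh1986, §14.34 (14.34.3)] -/
theorem Montgomery1973_simple_zeros_holds : Montgomery1973_simple_zeros :=
  Montgomery1973_simple_zeros_of_sum_sq_multiplicity Montgomery1973_sum_sq_multiplicity_holds

/-- **DISCHARGE of `Literature.NumberTheory.LFunctions.Montgomery1973_distinct_zeros`** (Montgomery
1973, as reported by Bui–Heath-Brown 2013, §1: "using the pair correlation of the zeros of the
Riemann zeta-function Montgomery [M] showed that `κ* ≥ 2/3` and `κ_d ≥ 5/6` on RH"): the counting
deduction `2 N_d ≥ 3 N − ∑ m²` (`Montgomery1973_distinct_zeros_of_sum_sq_multiplicity`,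
`SimpleZeros.lean`) applied to `Montgomery1973_sum_sq_multiplicity_holds`.
[cite: BuiHeathbrown2013, §1] -/
theorem Montgomery1973_distinct_zeros_holds : Montgomery1973_distinct_zeros :=
  Montgomery1973_distinct_zeros_of_sum_sq_multiplicity Montgomery1973_sum_sq_multiplicity_holds


end Literature.NumberTheory.LFunctions
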